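import Summits.QuantumFields.YangMills.Theorems.UnitScaleTiltProp7DefectTelescopeT3
import Summits.QuantumFields.YangMills.Theorems.UnitScaleTiltProp7OneStepDefectT3
import Summits.QuantumFields.YangMills.Theorems.UnitScaleTiltProp7QTwFlatExplicitT3
import HarnessLib

/-!
# Route `UnitScaleTilt`, crux K1 «MinimiserStabilityRegPr» (stmt-QuantumFields-19200) — route-R E′ (A′)-comb, COMB-FLAT-COERCIVITY, sub-lemma (I3′) «δQ-SLICE»,
# PLAN B (w4 g8 «(iii) := PLAN B P1–P4»), FILE P3-B «TELESCOPE — THE MEMBER»: **`QTw 1 X′ c − QTwS 1 X c = A_k X′ ĉ + (Φ_k X′ ĉ₊ − Φ_k X′ ĉ₋)`**, `k = K − n`,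
# for the (A, Φ) families of ✓`Prop7DefectTelescope.linFamily_sub_prod_eq_A_add_grad` run with px21's cornered one-step letter `γ_j` (P2 ✓`Prop7OneStepDefect`) —
# the comb-minus-sym defect of the flat member IS the one-step recursion, by name

Cell `ym3-torus`, width seat `ym3-torus-px22` (gen 5).  THEOREMS ONLY (0 `def`, 0 `sorry`); `--supports stmt-QuantumFields-19200 --as helper`, count-neutral.  YM₃ on T³ is a
ladder rung (R3), not the Clay problem; nothing here claims (I3′), COMB-FLAT-COERCIVITY, A6ᶜ, `hN06`, hcoS, E′, EX, the crux, d = 4 or the mass gap.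

WHY.  P3-A (✓p701988) is the algebra: for ANY cornered one-step family `γ_j = t′_j − d∘φ_j` intertwining gradients like `linAvg`, `Q⁽ʲ⁾x − Πγ_{<j}x = A_j x + d_jΦ_j x`.  The member
needs one IDENTIFICATION: with `X′ := X ∘ translate(−x₀)` (px13's τ, RULING №18) and px21's letter `γ_j Y c := (Lᵈ)⁻¹Σ_r segSum Y (emb c₋ + r) c.dir L − (Φ̂ Y c₊ − Φ̂ Y c₋)`,
`Φ̂ Y y := (Lᵈ)⁻¹Σ_r walkSum Y (walk (emb y) (treeWord r))`, the comb product satisfies `Πγ_{<k} X′ (ĉ) = Lᵏ·(Q_kX)(ĉ) + (r₁X′(c₋) − r₁X′(c₊))` (§4), so ✓`QTw_one_apply` and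
✓`QTwS_one_apply` give `QTw 1 X′ c − QTwS 1 X c = Q⁽ᵏ⁾X′ ĉ − Πγ_{<k}X′ ĉ = A_k X′ ĉ + dΦ_k X′ ĉ` (§5).  §4 = two closed forms by induction over the levels, reading the cornered
letters through lit's `ℤᵈ` objects `linQ`∕`linQIter`∕`Fhat` of the pullback (px21 ✓`cornerTube_eq_linQ_pull`, ✓`cornerFrame_eq_Fhat_pull`, ✓`linQIter_pull_eq_boxMean_segSum`,
✓`frameResponse_level_eq_centred`): (B2′) `T′_j X′ b = linQIter L (X′♯_{embIter j b₋}) j 0 b.dir`; (B3′) `Ψ′_j X′ s = Σ_{i<j} Fhat L (linQIter L (X′♯_{embIter j s}) i) 0`.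
WHAT IS PROVED (ns `…Theorems.Prop7DefectTelescopeMember`): §1 letters (`segSum_add_field`, `scaleCoord_intCast`, ★`emb_transl`∕`embIter_transl`, `pull_transl`, `linQIter_pull_transl`);
§2 ★★`cornerTubeProd_eq_linQIter` (B2′), `cornerTubeProd_pull_emb`; §3 ★★`cornerFrameAcc_eq_sum_Fhat` (B3′); §4 `transl_embIter_sub_basePt`, ★★`cornerTubeProd_top_eq_tube`
(`T′_k X′ = Lᵏ·Q_kX`), ★★`frameResponse_level_eq_Fhat_centre`, `frameResponse_eq_cornerFrameAcc` (`r₁X′ y = Ψ′_k X′ ŷ`); §5 `cornerLetter_add`, ★★★`defect_eq_A_add_grad` — THE MEMBER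
IDENTITY, the input of P4 (px6) together with P3-A's recursions `hAs`∕`hΦs`.  HONEST SCOPE: identities (finite sums, torus ↔ `ℤᵈ` bookkeeping); no estimate.  Rung R3, not Clay.

References: T. Bałaban, CMP 98 (1985) 17–51 [Balaban1985Averaging] ((62) p.28, (110)–(112) p.34, (124)–(127) pp.36–37, (160) p.42); CMP 95 (1984) 17–40 [Balaban1984PropagatorsI]
((1.8)–(1.20) pp.19–20); CMP 99 (1985) 389–434 [Balaban1985BackgroundPropagators] ((3.14) p.393).
-/

set_option autoImplicit false

noncomputable section

open scoped Matrix.Norms.L2Operator BigOperators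

namespace Summit.QuantumFields.YangMills.Theorems.Prop7DefectTelescopeMember

open Literature.MathematicalPhysics.QuantumFieldTheory.Balaban1983to89
open B7Prop1Explicit renaming Site → LSite
open B7Prop1Explicit (asum boxVec treeWord e)
open B7Prop3Flat (Fhat linQ)
open B7Prop4Flat (linQIter linQIter_succ linQIter_eq_linQ_pow linQ_eq_sum)
open B10Eq27TorusAxialLog (transl transl_apply transl_add transl_zero)
open T4Continuum BlockAveraging LatticeFieldCalculus
open BlockAveragingEMLLinearised (walkSum linAvg combMean linAvg_grad linAvg_eq_bondAvg_sub_grad_combMean)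
open B15DeterminingSets (embIter)
open Summit.QuantumFields.YangMills.Theorems.Prop7LinAvgOnto (linAvg_add walkSum_add')
open Summit.QuantumFields.YangMills.Theorems.Prop7DefectChainForms (linQIter_pull_eq_boxMean_segSum Fhat_eq_sum_treeWord segSum_translate)
open Summit.QuantumFields.YangMills.Theorems.Prop7OneStepDefect (oneStepDefect_grad cornerTube_eq_linQ_pull cornerFrame_eq_Fhat_pull)
open Summit.QuantumFields.YangMills.Theorems.Prop7DefectTelescope (prod_eq_tube_sub_grad linFamily_sub_prod_eq_A_add_grad)

variable {P : Params} {j : ℕ}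

/-! ## §1 Letters: additivity, the scaling of integer translations, translation covariance of the `ℤᵈ` averages -/

section Letters

variable {V : Type*} [AddCommGroup V]

/-- Straight contour sums are additive in the field. [cite: Balaban1984PropagatorsI, (1.8) p.19] -/
theorem segSum_add_field (Y Y' : PBond P j → V) (x : Site P j) (μ : Fin P.d) (N : ℕ) :
    segSum (fun b : PBond P j => Y b + Y' b) x μ N = segSum Y x μ N + segSum Y' x μ N := by
  unfold segSum
  rw [← Finset.sum_add_distrib]

/-- The cross-level scaling of an integer label: `scaleCoord (z·) = (L·z)·` from `ℤ∕N_{j+1}` to `ℤ∕N_j` (`N_j ∣ L·N_{j+1}`, any `j`). [cite: Balaban1987RG1, (0.1) p.251] -/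
theorem scaleCoord_intCast (z : ℤ) :
    Site.scaleCoord P j ((z : ℤ) : ZMod (P.sitesPerDir (j + 1))) = ((((P.L : ℤ) * z : ℤ)) : ZMod (P.sitesPerDir j)) := by
  rw [Site.scaleCoord_apply]
  set w : ZMod (P.sitesPerDir (j + 1)) := ((z : ℤ) : ZMod (P.sitesPerDir (j + 1))) with hw
  -- `w.val ≡ z (mod N_{j+1})`, hence `w.val·L ≡ z·L (mod N_j)` since `N_j ∣ L·N_{j+1}`
  have h1 : ((w.val : ℤ) : ZMod (P.sitesPerDir (j + 1))) = ((z : ℤ) : ZMod (P.sitesPerDir (j + 1))) := by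
    rw [Int.cast_natCast, ZMod.natCast_zmod_val]
  have hdvd : ((P.sitesPerDir (j + 1) : ℕ) : ℤ) ∣ z - (w.val : ℤ) := (ZMod.intCast_eq_intCast_iff_dvd_sub _ _ _).1 h1
  have hdvd' : ((P.sitesPerDir j : ℕ) : ℤ) ∣ (P.L : ℤ) * z - ((w.val * P.L : ℕ) : ℤ) := by
    have h2 : ((P.sitesPerDir j : ℕ) : ℤ) ∣ ((P.sitesPerDir (j + 1) * P.L : ℕ) : ℤ) := Int.natCast_dvd_natCast.mpr (P.sitesPerDir_dvd_succ_mul j)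
    refine h2.trans ?_
    rw [show (P.L : ℤ) * z - ((w.val * P.L : ℕ) : ℤ) = (z - (w.val : ℤ)) * (P.L : ℤ) by push_cast; ring, Nat.cast_mul]
    exact mul_dvd_mul hdvd (dvd_refl _)
  have h3 : (((w.val * P.L : ℕ) : ℤ) : ZMod (P.sitesPerDir j)) = ((((P.L : ℤ) * z : ℤ)) : ZMod (P.sitesPerDir j)) :=
    (ZMod.intCast_eq_intCast_iff_dvd_sub _ _ _).2 hdvd'
  rw [← h3, Int.cast_natCast]

/-- `emb (y + z·) = emb y + (L·z)·`: the centre embedding intertwines integer translations (coordinatewise `emb y κ = scaleCoord (y κ) + (L−1)∕2`). [cite: Balaban1987RG1, (0.1) p.251] -/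
theorem emb_transl (y : Site P (j + 1)) (z : LSite P.d) : emb (transl y z) = transl (emb y) ((P.L : ℤ) • z) := by
  funext ν
  rw [Site.emb_apply_eq, transl_apply, transl_apply, Site.emb_apply_eq, map_add, scaleCoord_intCast]
  simp only [Pi.smul_apply, smul_eq_mul]
  push_cast
  ring

/-- ★ **`embIter j (y + z·) = embIter j y + (Lʲ·z)·`** — the `j`-fold centre embedding intertwines integer translations with their `Lʲ`-folds. [cite: Balaban1987RG1, (0.1) p.251] -/
theorem embIter_transl : ∀ (j : ℕ) (y : Site P j) (z : LSite P.d), embIter j (transl y z) = transl (embIter j y) (((P.L : ℤ) ^ j) • z)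
  | 0, y, z => by rw [pow_zero, one_smul]; rfl
  | j + 1, y, z => by
    show embIter j (emb (transl y z)) = transl (embIter j (emb y)) (((P.L : ℤ) ^ (j + 1)) • z)
    rw [emb_transl, embIter_transl j, smul_smul, ← pow_succ]

/-- Re-basing the `ℤᵈ` pullback: `X♯_{y + a·}(z) = X♯_y(a + z)`. [cite: Balaban1984PropagatorsI, (1.8) p.19] -/
theorem pull_transl {𝔸 : Type*} (X : PBond P j → 𝔸) (y : Site P j) (a : LSite P.d) :
    (fun (z : LSite P.d) (κ : Fin P.d) => X ⟨transl (transl y a) z, κ⟩) = fun (z : LSite P.d) (κ : Fin P.d) => X ⟨transl y (a + z), κ⟩ := by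
  funext z κ; rw [transl_add]

/-- Translation covariance of lit's iterated linear average, for pullbacks: `Q_j(x♯_y(Lʲ·a + ·))(w) = Q_j(x♯_y)(a + w)`. [cite: Balaban1984PropagatorsI, (1.18) p.20] -/
theorem linQIter_pull_transl {𝔸 : Type*} [NormedRing 𝔸] [NormedAlgebra ℂ 𝔸] (L : ℕ) (x : PBond P j → 𝔸) (y : Site P j) (i : ℕ) (a w : LSite P.d) (κ : Fin P.d) :
    linQIter L (fun (z : LSite P.d) (κ : Fin P.d) => x ⟨transl y (((L : ℤ) ^ i) • a + z), κ⟩) i w κ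
      = linQIter L (fun (z : LSite P.d) (κ : Fin P.d) => x ⟨transl y z, κ⟩) i (a + w) κ := by
  rw [linQIter_eq_linQ_pow, linQIter_eq_linQ_pow, linQ_eq_sum, linQ_eq_sum]
  refine Finset.sum_congr rfl fun r _ => ?_
  congr 1
  refine Finset.sum_congr rfl fun t _ => ?_
  have hL : ((L : ℤ) ^ i) = (((L ^ i : ℕ) : ℤ)) := by push_cast; rfl
  rw [hL, smul_add, ← add_assoc, ← add_assoc]

end Letters

/-! ## §2 (B2′) The cornered tube product in closed form -/

section TubeProduct

variable {n : Type*} [Fintype n] [DecidableEq n]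

/-- ★★ **(B2′) THE CORNERED TUBE PRODUCT IS lit's ITERATED LINEAR AVERAGE OF THE PULLBACK AT THE BLOCK's FINE CENTRE**: `T′_j x b = linQIter L (x♯_{embIter j b₋}) j 0 b.dir` for the
product of px21's cornered one-step tube (induction: ✓`cornerTube_eq_linQ_pull`, lit ✓`linQIter_succ`, `embIter_transl`, `linQIter_pull_transl`). [cite: Balaban1984PropagatorsI, (1.16)–(1.18) p.20; Balaban1985Averaging, (125) p.36] -/
theorem cornerTubeProd_eq_linQIter
    (T' : (j : ℕ) → (PBond P 0 → Matrix n n ℂ) → PBond P j → Matrix n n ℂ)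
    (hT0 : ∀ x, T' 0 x = x)
    (hTs : ∀ (j : ℕ) (x : PBond P 0 → Matrix n n ℂ) (c : PBond P (j + 1)),
      T' (j + 1) x c = ((((P.L : ℝ)) ^ P.d)⁻¹) • ∑ r : Fin P.d → Fin P.L, segSum (T' j x) (transl (emb c.src) (boxVec P.L r)) c.dir P.L)
    (x : PBond P 0 → Matrix n n ℂ) :
    ∀ (j : ℕ) (b : PBond P j), T' j x b = linQIter P.L (fun (z : LSite P.d) (κ : Fin P.d) => x ⟨transl (embIter j b.src) z, κ⟩) j 0 b.dir := by
  intro j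
  induction j with
  | zero =>
    intro b
    rw [hT0, B7Prop4Flat.linQIter_zero, transl_zero]
    rfl
  | succ j ih =>
    intro c
    rw [hTs, cornerTube_eq_linQ_pull, linQIter_succ, smul_zero]
    congr 1
    funext z κ
    rw [ih ⟨transl (emb c.src) z, κ⟩]
    show linQIter P.L (fun (w : LSite P.d) (κ' : Fin P.d) => x ⟨transl (embIter j (transl (emb c.src) z)) w, κ'⟩) j 0 κ = _
    rw [embIter_transl, pull_transl, linQIter_pull_transl, add_zero]
    rfl

/-- (B2′) at the translated base child: `z ↦ T′_j x ⟨emb y + z, κ⟩` IS `linQIter L (x♯_{embIter (j+1) y}) j` as a function on `ℤᵈ`. [cite: Balaban1984PropagatorsI, (1.18) p.20] -/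
theorem cornerTubeProd_pull_emb
    (T' : (j : ℕ) → (PBond P 0 → Matrix n n ℂ) → PBond P j → Matrix n n ℂ)
    (hT0 : ∀ x, T' 0 x = x)
    (hTs : ∀ (j : ℕ) (x : PBond P 0 → Matrix n n ℂ) (c : PBond P (j + 1)),
      T' (j + 1) x c = ((((P.L : ℝ)) ^ P.d)⁻¹) • ∑ r : Fin P.d → Fin P.L, segSum (T' j x) (transl (emb c.src) (boxVec P.L r)) c.dir P.L)
    (x : PBond P 0 → Matrix n n ℂ) (j : ℕ) (y : Site P (j + 1)) :
    (fun (z : LSite P.d) (κ : Fin P.d) => T' j x ⟨transl (emb y) z, κ⟩)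
      = linQIter P.L (fun (z : LSite P.d) (κ : Fin P.d) => x ⟨transl (embIter (j + 1) y) z, κ⟩) j := by
  funext z κ
  rw [cornerTubeProd_eq_linQIter T' hT0 hTs x j ⟨transl (emb y) z, κ⟩]
  show linQIter P.L (fun (w : LSite P.d) (κ' : Fin P.d) => x ⟨transl (embIter j (transl (emb y) z)) w, κ'⟩) j 0 κ = _
  rw [embIter_transl, pull_transl, linQIter_pull_transl, add_zero]
  rfl

end TubeProduct

/-! ## §3 (B3′) The accumulated comb potential in closed form -/

section FramePotential

variable {n : Type*} [Fintype n] [DecidableEq n]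

/-- ★★ **(B3′) THE ACCUMULATED COMB POTENTIAL IS THE LEVEL SUM OF lit's FRAME LINEARISATIONS `F̂` AT THE SITE's FINE CENTRE**: for `Ψ′_0 = 0`,
`Ψ′_{j+1} x y = Ψ′_j x (emb y) + (Lᵈ)⁻¹Σ_r walkSum (T′_j x) (walk (emb y) (treeWord r))`: `Ψ′_j x s = Σ_{i<j} Fhat L (linQIter L (x♯_{embIter j s}) i) 0`. [cite: Balaban1985Averaging, (110)–(112) p.34, (160) p.42] -/
theorem cornerFrameAcc_eq_sum_Fhat
    (T' : (j : ℕ) → (PBond P 0 → Matrix n n ℂ) → PBond P j → Matrix n n ℂ)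
    (hT0 : ∀ x, T' 0 x = x)
    (hTs : ∀ (j : ℕ) (x : PBond P 0 → Matrix n n ℂ) (c : PBond P (j + 1)),
      T' (j + 1) x c = ((((P.L : ℝ)) ^ P.d)⁻¹) • ∑ r : Fin P.d → Fin P.L, segSum (T' j x) (transl (emb c.src) (boxVec P.L r)) c.dir P.L)
    (Ψ' : (j : ℕ) → (PBond P 0 → Matrix n n ℂ) → Site P j → Matrix n n ℂ)
    (hΨ0 : ∀ x y, Ψ' 0 x y = 0)
    (hΨs : ∀ (j : ℕ) (x : PBond P 0 → Matrix n n ℂ) (y : Site P (j + 1)),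
      Ψ' (j + 1) x y = Ψ' j x (emb y) + ((((P.L : ℝ)) ^ P.d)⁻¹) • ∑ r : Fin P.d → Fin P.L, walkSum (T' j x) (walk (emb y) (treeWord (boxVec P.L r))))
    (x : PBond P 0 → Matrix n n ℂ) :
    ∀ (j : ℕ) (s : Site P j), Ψ' j x s = ∑ i ∈ Finset.range j, Fhat P.L (linQIter P.L (fun (z : LSite P.d) (κ : Fin P.d) => x ⟨transl (embIter j s) z, κ⟩) i) 0 := by
  intro j
  induction j with
  | zero => intro s; rw [hΨ0, Finset.range_zero, Finset.sum_empty]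
  | succ j ih =>
    intro s
    rw [hΨs, ih (emb s), cornerFrame_eq_Fhat_pull, cornerTubeProd_pull_emb T' hT0 hTs x j s, Finset.sum_range_succ]
    rfl

end FramePotential

/-! ## §4 At the T³ member: the top of the cornered tube product is `Lᵏ·Q_kX`, the accumulated potential is `r₁` -/

section Member

open Literature.MathematicalPhysics.QuantumFieldTheory.Balaban1983to89.T3ContinuumYM3Torus
open T3LevelShift (siteShift bondShift bondShift_src bondShift_tgt)
open T3PrintedRegularOrbits (sites_eq)
open Summit.QuantumFields.YangMills.Theorems.Prop7SPrint (basePt)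
open Summit.QuantumFields.YangMills.Theorems.Prop7SymAvgTw (coordT3 QTw)
open Summit.QuantumFields.YangMills.Theorems.Prop7SymAvgTwSym (QTwS QTwS_one_apply)
open Summit.QuantumFields.YangMills.Theorems.Prop7AxialReprPrint (embIter_eq_transl)
open Summit.QuantumFields.YangMills.Theorems.Prop7CmapTwSReadSet (height_le)
open Summit.QuantumFields.YangMills.Theorems.Prop7DefectChainForms (frameResponse_level_eq_centred csmul_bondAvgIter_eq_blockMean_segSum)
open Summit.QuantumFields.YangMills.Theorems.Prop7QTwFlatExplicit (QTw_one_apply)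
open B5Eq118OneStroke (iterBlock)
open B5Eq117TorusCarriers (blockSiteK sum_iterBlock_eq)

variable (F : T3Family) {n K : ℕ} (h : n ≤ K)

/-- The block `Bᵏ(s)` enumerated from the fine centre `x̂ = embIter k s` shifted back by the base point `x₀ = embIter k 0`: `x̂ + r − x₀` is the block point of label `Lᵏ·s + r`.
[cite: Balaban1987RG1, (0.1) p.252; Balaban1984PropagatorsI, (1.18) p.20] -/
theorem transl_embIter_sub_basePt (s : Site (F.P K) (K - n)) (u : Fin (F.P K).d → Fin ((F.P K).L ^ (K - n))) :
    transl (embIter (K - n) s) (boxVec ((F.P K).L ^ (K - n)) u) + -basePt F n K = blockSiteK (K - n) s u := by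
  have he := embIter_eq_transl (P := F.P K) (k := K - n) (height_le F n K) s
  funext ν
  rw [Site.add_apply, transl_apply, he, transl_apply]
  show embIter (K - n) (0 : Site (F.P K) (K - n)) ν + _ + _ + (-(basePt F n K)) ν = _
  have hb : (-(basePt F n K)) ν = -(embIter (K - n) (0 : Site (F.P K) (K - n)) ν) := rfl
  rw [hb, blockSiteK]
  simp only [Pi.smul_apply, smul_eq_mul, boxVec]
  push_cast
  ring

/-- ★★ **THE TOP OF THE CORNERED TUBE PRODUCT OF `X′ = X ∘ translate(−x₀)` IS PRINT's `Lᵏ·Q_kX`**: `T′_k X′ b = Lᵏ•bondAvgIter k X b`, `k = K − n` (§2, px21 ✓`segSum_translate`,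
`transl_embIter_sub_basePt`, px21 ✓`csmul_bondAvgIter_eq_blockMean_segSum`). [cite: Balaban1984PropagatorsI, (1.18) p.20; Balaban1985Variational, (44)–(45) p.285] -/
theorem cornerTubeProd_top_eq_tube
    (T' : (j : ℕ) → (PBond (F.P K) 0 → Matrix (Fin 2) (Fin 2) ℂ) → PBond (F.P K) j → Matrix (Fin 2) (Fin 2) ℂ)
    (hT0 : ∀ x, T' 0 x = x)
    (hTs : ∀ (j : ℕ) (x : PBond (F.P K) 0 → Matrix (Fin 2) (Fin 2) ℂ) (c : PBond (F.P K) (j + 1)),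
      T' (j + 1) x c = (((((F.P K).L : ℝ)) ^ (F.P K).d)⁻¹) • ∑ r : Fin (F.P K).d → Fin (F.P K).L, segSum (T' j x) (transl (emb c.src) (boxVec (F.P K).L r)) c.dir (F.P K).L)
    (X : PBond (F.P K) 0 → Matrix (Fin 2) (Fin 2) ℂ) (b : PBond (F.P K) (K - n)) :
    T' (K - n) (fun b' : PBond (F.P K) 0 => X (b'.translate (-basePt F n K))) b = ((((F.P K).L : ℕ) : ℂ) ^ (K - n)) • bondAvgIter (K - n) X b := by
  rw [cornerTubeProd_eq_linQIter T' hT0 hTs _ (K - n) b,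
    linQIter_pull_eq_boxMean_segSum (F.P K).L (fun b' : PBond (F.P K) 0 => X (b'.translate (-basePt F n K))) (embIter (K - n) b.src) (K - n) 0 b.dir,
    csmul_bondAvgIter_eq_blockMean_segSum F, sum_iterBlock_eq (height_le F n K), Finset.smul_sum]
  refine Finset.sum_congr rfl fun u _ => ?_
  rw [smul_zero, zero_add, segSum_translate, transl_embIter_sub_basePt F]
  congr 1
  push_cast
  ring

/-- ★★ **THE LEVEL-`i` SUMMAND OF `r₁X′ y` IS lit's `F̂` AT THE CENTRE `x̂_y = embIter k (siteShift y)`** (px21 ✓`frameResponse_level_eq_centred` ∘ ✓`Fhat_eq_sum_treeWord` ∘ ✓`linQIter_pull_eq_boxMean_segSum`).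
[cite: Balaban1985Averaging, (160) p.42, (112) p.34, (127) p.37] -/
theorem frameResponse_level_eq_Fhat_centre (X : PBond (F.P K) 0 → Matrix (Fin 2) (Fin 2) ℂ) (y : Site (F.P n) 0) {i : ℕ} (hi : i ≤ K - n) :
    Fhat (F.P K).L (linQIter (F.P K).L (fun (z : LSite (F.P K).d) (κ : Fin (F.P K).d) => X ⟨transl (basePt F n K) z, κ⟩) i)
        ((((F.P K).L : ℤ) ^ (K - n - i)) • coordT3 F n K h y)
      = Fhat (F.P K).L (linQIter (F.P K).L (fun (z : LSite (F.P K).d) (κ : Fin (F.P K).d) => X ⟨transl (embIter (K - n) (siteShift (sites_eq F n K h) y)) z, κ⟩) i) 0 := by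
  rw [frameResponse_level_eq_centred F h X y hi, Fhat_eq_sum_treeWord]
  refine Finset.sum_congr rfl fun r _ => ?_
  congr 1
  congr 1
  funext w κ
  rw [linQIter_pull_eq_boxMean_segSum]

/-- ★★ **`r₁X′ y` IS THE ACCUMULATED COMB POTENTIAL AT `ŷ`**: `Σ_{i<k} Fhat L (linQIter L X′♯_{x₀} i)(L^{k−i}•ŷ) = Ψ′_k X′ (siteShift y)` for the family of §3.
[cite: Balaban1985Averaging, (160)–(163) p.42, (110)–(112) p.34] -/
theorem frameResponse_eq_cornerFrameAcc
    (T' : (j : ℕ) → (PBond (F.P K) 0 → Matrix (Fin 2) (Fin 2) ℂ) → PBond (F.P K) j → Matrix (Fin 2) (Fin 2) ℂ)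
    (hT0 : ∀ x, T' 0 x = x)
    (hTs : ∀ (j : ℕ) (x : PBond (F.P K) 0 → Matrix (Fin 2) (Fin 2) ℂ) (c : PBond (F.P K) (j + 1)),
      T' (j + 1) x c = (((((F.P K).L : ℝ)) ^ (F.P K).d)⁻¹) • ∑ r : Fin (F.P K).d → Fin (F.P K).L, segSum (T' j x) (transl (emb c.src) (boxVec (F.P K).L r)) c.dir (F.P K).L)
    (Ψ' : (j : ℕ) → (PBond (F.P K) 0 → Matrix (Fin 2) (Fin 2) ℂ) → Site (F.P K) j → Matrix (Fin 2) (Fin 2) ℂ)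
    (hΨ0 : ∀ x y, Ψ' 0 x y = 0)
    (hΨs : ∀ (j : ℕ) (x : PBond (F.P K) 0 → Matrix (Fin 2) (Fin 2) ℂ) (y : Site (F.P K) (j + 1)),
      Ψ' (j + 1) x y = Ψ' j x (emb y) + (((((F.P K).L : ℝ)) ^ (F.P K).d)⁻¹) • ∑ r : Fin (F.P K).d → Fin (F.P K).L, walkSum (T' j x) (walk (emb y) (treeWord (boxVec (F.P K).L r))))
    (X : PBond (F.P K) 0 → Matrix (Fin 2) (Fin 2) ℂ) (y : Site (F.P n) 0) :
    ∑ i ∈ Finset.range (K - n), Fhat (F.P K).L (linQIter (F.P K).L (fun (z : LSite (F.P K).d) (κ : Fin (F.P K).d) => X ⟨transl (basePt F n K) z, κ⟩) i)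
        ((((F.P K).L : ℤ) ^ (K - n - i)) • coordT3 F n K h y)
      = Ψ' (K - n) X (siteShift (sites_eq F n K h) y) := by
  rw [cornerFrameAcc_eq_sum_Fhat T' hT0 hTs Ψ' hΨ0 hΨs X (K - n)]
  exact Finset.sum_congr rfl fun i hi => frameResponse_level_eq_Fhat_centre F h X y (Finset.mem_range.1 hi).le

end Member

/-! ## §5 ★★★ The member identity: `QTw 1 X′ c − QTwS 1 X c = A_k X′ ĉ + dΦ_k X′ ĉ` -/

section Main

open Literature.MathematicalPhysics.QuantumFieldTheory.Balaban1983to89.T3ContinuumYM3Torus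
open T3LevelShift (siteShift bondShift bondShift_src bondShift_tgt)
open T3PrintedRegularOrbits (sites_eq)
open Summit.QuantumFields.YangMills.Theorems.Prop7SPrint (basePt)
open Summit.QuantumFields.YangMills.Theorems.Prop7SymAvgTw (coordT3 QTw)
open Summit.QuantumFields.YangMills.Theorems.Prop7SymAvgTwSym (QTwS QTwS_one_apply)
open Summit.QuantumFields.YangMills.Theorems.Prop7QTwFlatExplicit (QTw_one_apply)
open Summit.QuantumFields.YangMills.Theorems.Prop7DefectTelescope (grad_add)

variable (F : T3Family) {n K : ℕ} (h : n ≤ K)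

/-- px21's cornered one-step letter is additive in the field (straight contours and tree walks are). [cite: Balaban1984PropagatorsI, (1.8) p.19; Balaban1985Averaging, (112) p.34] -/
theorem cornerLetter_add {P : Params} {j : ℕ} {m : Type*} (Y Y' : PBond P j → Matrix m m ℂ) (c : PBond P (j + 1)) :
    (((((P.L : ℝ)) ^ P.d)⁻¹) • ∑ r : Fin P.d → Fin P.L, segSum (Y + Y') (transl (emb c.src) (boxVec P.L r)) c.dir P.L
        - ( ((((P.L : ℝ)) ^ P.d)⁻¹) • ∑ r : Fin P.d → Fin P.L, walkSum (Y + Y') (walk (emb c.tgt) (treeWord (boxVec P.L r)))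
            - ((((P.L : ℝ)) ^ P.d)⁻¹) • ∑ r : Fin P.d → Fin P.L, walkSum (Y + Y') (walk (emb c.src) (treeWord (boxVec P.L r))) ))
      = (((((P.L : ℝ)) ^ P.d)⁻¹) • ∑ r : Fin P.d → Fin P.L, segSum Y (transl (emb c.src) (boxVec P.L r)) c.dir P.L
          - ( ((((P.L : ℝ)) ^ P.d)⁻¹) • ∑ r : Fin P.d → Fin P.L, walkSum Y (walk (emb c.tgt) (treeWord (boxVec P.L r)))
              - ((((P.L : ℝ)) ^ P.d)⁻¹) • ∑ r : Fin P.d → Fin P.L, walkSum Y (walk (emb c.src) (treeWord (boxVec P.L r))) ))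
        + (((((P.L : ℝ)) ^ P.d)⁻¹) • ∑ r : Fin P.d → Fin P.L, segSum Y' (transl (emb c.src) (boxVec P.L r)) c.dir P.L
          - ( ((((P.L : ℝ)) ^ P.d)⁻¹) • ∑ r : Fin P.d → Fin P.L, walkSum Y' (walk (emb c.tgt) (treeWord (boxVec P.L r)))
              - ((((P.L : ℝ)) ^ P.d)⁻¹) • ∑ r : Fin P.d → Fin P.L, walkSum Y' (walk (emb c.src) (treeWord (boxVec P.L r))) )) := by
  have e1 : ∀ (x : Site P j) (μ : Fin P.d) (N : ℕ), segSum (Y + Y') x μ N = segSum Y x μ N + segSum Y' x μ N :=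
    fun x μ N => segSum_add_field Y Y' x μ N
  have e2 : ∀ γ : List (LStep P j), walkSum (Y + Y') γ = walkSum Y γ + walkSum Y' γ := fun γ => walkSum_add' Y Y' γ
  simp only [e1, e2, Finset.sum_add_distrib, smul_add]
  abel

/-- ★★★ **THE COMB-MINUS-SYM DEFECT OF THE FLAT MEMBER IS THE ONE-STEP (A, Φ) RECURSION.**  For the member `(F, n ≤ K)`, `k = K − n`, every `X` and coarse bond `c`, with
`X′ := X ∘ translate(−x₀)` (`x₀ = basePt F n K`) and `ĉ := bondShift (sites_eq F n K h) c`: `QTw F n K h 1 X′ c − QTwS F n K h 1 X c = A_k X′ ĉ + (Φ_k X′ ĉ₊ − Φ_k X′ ĉ₋)`, where `(A, Φ)`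
are P3-A's families run with `σ_j = linAvg` and px21's cornered letter `γ_j`: `A_{j+1} x c = L•(Q A_j x)(c) + [linAvg (T′_j x) c − γ_j (T′_j x) c]`, `Φ_{j+1} x y = Φ_j x (emb y) − λ̄_{A_j x}(y)`.
PROOF: ✓`QTw_one_apply` + ✓`QTwS_one_apply` + P3-A ✓`linFamily_sub_prod_eq_A_add_grad` + `Πγ_{<k}X′ ĉ = Lᵏ•Q_kX ĉ − (r₁X′ c₊ − r₁X′ c₋)` (P3-A ✓`prod_eq_tube_sub_grad` for `γ`, §4).  Input of px6's P4 ∕ w4's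
FILE B′ `sliceBound_basePt_of_sqBound`. [cite: Balaban1985BackgroundPropagators, (3.14) p.393, Thm 3.11 p.416; Balaban1985Averaging, (124)–(127) pp.36–37, (160) p.42; Balaban1984PropagatorsI, (1.18) p.20] -/
theorem defect_eq_A_add_grad
    (Q : (i : ℕ) → (PBond (F.P K) 0 → Matrix (Fin 2) (Fin 2) ℂ) → PBond (F.P K) i → Matrix (Fin 2) (Fin 2) ℂ)
    (hQ0 : ∀ Y, Q 0 Y = Y)
    (hQs : ∀ (i : ℕ) (Y : PBond (F.P K) 0 → Matrix (Fin 2) (Fin 2) ℂ) (c : PBond (F.P K) (i + 1)), Q (i + 1) Y c = linAvg (Q i Y) c)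
    (G : (j : ℕ) → (PBond (F.P K) 0 → Matrix (Fin 2) (Fin 2) ℂ) → PBond (F.P K) j → Matrix (Fin 2) (Fin 2) ℂ)
    (hG0 : ∀ x, G 0 x = x)
    (hGs : ∀ (j : ℕ) (x : PBond (F.P K) 0 → Matrix (Fin 2) (Fin 2) ℂ) (c : PBond (F.P K) (j + 1)),
      G (j + 1) x c = ((((F.P K).L : ℝ)) ^ (F.P K).d)⁻¹ • ∑ r : Fin (F.P K).d → Fin (F.P K).L, segSum (G j x) (transl (emb c.src) (boxVec (F.P K).L r)) c.dir (F.P K).L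
        - ( ((((F.P K).L : ℝ)) ^ (F.P K).d)⁻¹ • ∑ r : Fin (F.P K).d → Fin (F.P K).L, walkSum (G j x) (walk (emb c.tgt) (treeWord (boxVec (F.P K).L r)))
            - ((((F.P K).L : ℝ)) ^ (F.P K).d)⁻¹ • ∑ r : Fin (F.P K).d → Fin (F.P K).L, walkSum (G j x) (walk (emb c.src) (treeWord (boxVec (F.P K).L r))) ))
    (T' : (j : ℕ) → (PBond (F.P K) 0 → Matrix (Fin 2) (Fin 2) ℂ) → PBond (F.P K) j → Matrix (Fin 2) (Fin 2) ℂ)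
    (hT0 : ∀ x, T' 0 x = x)
    (hTs : ∀ (j : ℕ) (x : PBond (F.P K) 0 → Matrix (Fin 2) (Fin 2) ℂ) (c : PBond (F.P K) (j + 1)),
      T' (j + 1) x c = (((((F.P K).L : ℝ)) ^ (F.P K).d)⁻¹) • ∑ r : Fin (F.P K).d → Fin (F.P K).L, segSum (T' j x) (transl (emb c.src) (boxVec (F.P K).L r)) c.dir (F.P K).L)
    (A : (j : ℕ) → (PBond (F.P K) 0 → Matrix (Fin 2) (Fin 2) ℂ) → PBond (F.P K) j → Matrix (Fin 2) (Fin 2) ℂ)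
    (hA0 : ∀ x b, A 0 x b = 0)
    (hAs : ∀ (j : ℕ) (x : PBond (F.P K) 0 → Matrix (Fin 2) (Fin 2) ℂ) (c : PBond (F.P K) (j + 1)),
      A (j + 1) x c = (((F.P K).L : ℕ) : ℂ) • bondAvg (A j x) c
        + (linAvg (T' j x) c
          - ( ((((F.P K).L : ℝ)) ^ (F.P K).d)⁻¹ • ∑ r : Fin (F.P K).d → Fin (F.P K).L, segSum (T' j x) (transl (emb c.src) (boxVec (F.P K).L r)) c.dir (F.P K).L
              - ( ((((F.P K).L : ℝ)) ^ (F.P K).d)⁻¹ • ∑ r : Fin (F.P K).d → Fin (F.P K).L, walkSum (T' j x) (walk (emb c.tgt) (treeWord (boxVec (F.P K).L r)))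
                  - ((((F.P K).L : ℝ)) ^ (F.P K).d)⁻¹ • ∑ r : Fin (F.P K).d → Fin (F.P K).L, walkSum (T' j x) (walk (emb c.src) (treeWord (boxVec (F.P K).L r))) ))))
    (Φ : (j : ℕ) → (PBond (F.P K) 0 → Matrix (Fin 2) (Fin 2) ℂ) → Site (F.P K) j → Matrix (Fin 2) (Fin 2) ℂ)
    (hΦ0 : ∀ x y, Φ 0 x y = 0)
    (hΦs : ∀ (j : ℕ) (x : PBond (F.P K) 0 → Matrix (Fin 2) (Fin 2) ℂ) (y : Site (F.P K) (j + 1)), Φ (j + 1) x y = Φ j x (emb y) - combMean (A j x) y)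
    (X : PBond (F.P K) 0 → Matrix (Fin 2) (Fin 2) ℂ) (c : PBond (F.P n) 0) :
    QTw F n K h 1 (fun b : PBond (F.P K) 0 => X (b.translate (-basePt F n K))) c - QTwS F n K h 1 X c
      = A (K - n) (fun b : PBond (F.P K) 0 => X (b.translate (-basePt F n K))) (bondShift (sites_eq F n K h) c)
        + (Φ (K - n) (fun b : PBond (F.P K) 0 => X (b.translate (-basePt F n K))) (bondShift (sites_eq F n K h) c).tgt
          - Φ (K - n) (fun b : PBond (F.P K) 0 => X (b.translate (-basePt F n K))) (bondShift (sites_eq F n K h) c).src) := by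
  -- letters (no `set`: the rewrites below must see the literal terms)
  -- the cornered tube `t′` and frame letter `φ̂`
  let t' : (j : ℕ) → (PBond (F.P K) j → Matrix (Fin 2) (Fin 2) ℂ) → PBond (F.P K) (j + 1) → Matrix (Fin 2) (Fin 2) ℂ := fun j Y c =>
    (((((F.P K).L : ℝ)) ^ (F.P K).d)⁻¹) • ∑ r : Fin (F.P K).d → Fin (F.P K).L, segSum Y (transl (emb c.src) (boxVec (F.P K).L r)) c.dir (F.P K).L
  let φf : (j : ℕ) → (PBond (F.P K) j → Matrix (Fin 2) (Fin 2) ℂ) → Site (F.P K) (j + 1) → Matrix (Fin 2) (Fin 2) ℂ := fun j Y y =>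
    (((((F.P K).L : ℝ)) ^ (F.P K).d)⁻¹) • ∑ r : Fin (F.P K).d → Fin (F.P K).L, walkSum Y (walk (emb y) (treeWord (boxVec (F.P K).L r)))
  let γf : (j : ℕ) → (PBond (F.P K) j → Matrix (Fin 2) (Fin 2) ℂ) → PBond (F.P K) (j + 1) → Matrix (Fin 2) (Fin 2) ℂ := fun j Y c => t' j Y c - (φf j Y c.tgt - φf j Y c.src)
  have hγadd : ∀ (j : ℕ) (Y Y' : PBond (F.P K) j → Matrix (Fin 2) (Fin 2) ℂ) (c : PBond (F.P K) (j + 1)), γf j (Y + Y') c = γf j Y c + γf j Y' c :=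
    fun j Y Y' c => cornerLetter_add Y Y' c
  have hγ : ∀ (j : ℕ) (Y : PBond (F.P K) j → Matrix (Fin 2) (Fin 2) ℂ) (c : PBond (F.P K) (j + 1)), γf j Y c = t' j Y c - (φf j Y c.tgt - φf j Y c.src) := fun _ _ _ => rfl
  have hγd : ∀ (j : ℕ) (ψ : Site (F.P K) j → Matrix (Fin 2) (Fin 2) ℂ) (c : PBond (F.P K) (j + 1)),
      γf j (fun b => ψ b.tgt - ψ b.src) c = ψ (emb c.tgt) - ψ (emb c.src) := by
    intro j ψ c
    have h0 := oneStepDefect_grad ψ c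
    rw [sub_eq_zero] at h0
    rw [← linAvg_grad ψ c, h0]
  -- (1) the (A, Φ) split of P3-A
  have hsplit := linFamily_sub_prod_eq_A_add_grad Q hQ0 hQs γf hγadd t' φf hγ hγd G hG0 (fun j x c => hGs j x c) T' hT0 (fun j x c => hTs j x c)
    A hA0 (fun j x c => hAs j x c) Φ hΦ0 hΦs (K - n) (fun b : PBond (F.P K) 0 => X (b.translate (-basePt F n K))) (bondShift (sites_eq F n K h) c)
  -- (2) the comb product `G = T′ − dΨ′` (P3-A's abstract lemma for `γ`)
  let Ψ' : (j : ℕ) → (PBond (F.P K) 0 → Matrix (Fin 2) (Fin 2) ℂ) → Site (F.P K) j → Matrix (Fin 2) (Fin 2) ℂ := fun j =>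
    Nat.rec (motive := fun j => (PBond (F.P K) 0 → Matrix (Fin 2) (Fin 2) ℂ) → Site (F.P K) j → Matrix (Fin 2) (Fin 2) ℂ) (fun _ _ => 0)
      (fun j Ψj x y => Ψj x (emb y) + φf j (T' j x) y) j
  have hΨ0 : ∀ x y, Ψ' 0 x y = 0 := fun _ _ => rfl
  have hΨs : ∀ (j : ℕ) (x : PBond (F.P K) 0 → Matrix (Fin 2) (Fin 2) ℂ) (y : Site (F.P K) (j + 1)), Ψ' (j + 1) x y = Ψ' j x (emb y) + φf j (T' j x) y := fun _ _ _ => rfl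
  let γ : ∀ j, (PBond (F.P K) j → Matrix (Fin 2) (Fin 2) ℂ) →+ (PBond (F.P K) (j + 1) → Matrix (Fin 2) (Fin 2) ℂ) := fun j =>
    AddMonoidHom.mk' (fun Y => fun c => γf j Y c) (fun Y Y' => funext fun c => hγadd j Y Y' c)
  let d : ∀ j, (Site (F.P K) j → Matrix (Fin 2) (Fin 2) ℂ) →+ (PBond (F.P K) j → Matrix (Fin 2) (Fin 2) ℂ) := fun j =>
    AddMonoidHom.mk' (fun ψ => fun b : PBond (F.P K) j => ψ b.tgt - ψ b.src) (fun ψ ψ' => grad_add ψ ψ')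
  have hprod := Prop7DefectTelescope.prod_eq_tube_sub_grad (B := fun j => PBond (F.P K) j → Matrix (Fin 2) (Fin 2) ℂ) (S := fun j => Site (F.P K) j → Matrix (Fin 2) (Fin 2) ℂ)
    γ d t' φf (fun j ψ y => ψ (emb y)) (fun j Y => funext fun c => hγ j Y c) (fun j ψ => funext fun c => hγd j ψ c)
    G hG0 (fun j x => funext fun c => hGs j x c) T' hT0 (fun j x => funext fun c => hTs j x c) Ψ' (fun x => funext fun y => hΨ0 x y) (fun j x => funext fun y => hΨs j x y)
    (K - n) (fun b : PBond (F.P K) 0 => X (b.translate (-basePt F n K)))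
  have hG : G (K - n) (fun b : PBond (F.P K) 0 => X (b.translate (-basePt F n K))) (bondShift (sites_eq F n K h) c) = T' (K - n) (fun b : PBond (F.P K) 0 => X (b.translate (-basePt F n K))) (bondShift (sites_eq F n K h) c) - (Ψ' (K - n) (fun b : PBond (F.P K) 0 => X (b.translate (-basePt F n K))) (bondShift (sites_eq F n K h) c).tgt - Ψ' (K - n) (fun b : PBond (F.P K) 0 => X (b.translate (-basePt F n K))) (bondShift (sites_eq F n K h) c).src) := congrFun hprod (bondShift (sites_eq F n K h) c)
  -- (3) the top of the tube product and the accumulated potential at the member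
  have hT := cornerTubeProd_top_eq_tube F T' hT0 hTs X (bondShift (sites_eq F n K h) c)
  have hΨtgt := frameResponse_eq_cornerFrameAcc F h T' hT0 hTs Ψ' hΨ0 hΨs (fun b : PBond (F.P K) 0 => X (b.translate (-basePt F n K))) c.tgt
  have hΨsrc := frameResponse_eq_cornerFrameAcc F h T' hT0 hTs Ψ' hΨ0 hΨs (fun b : PBond (F.P K) 0 => X (b.translate (-basePt F n K))) c.src
  have htgt : (bondShift (sites_eq F n K h) c).tgt = siteShift (sites_eq F n K h) c.tgt := bondShift_tgt _ c
  have hsrc : (bondShift (sites_eq F n K h) c).src = siteShift (sites_eq F n K h) c.src := bondShift_src _ c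
  -- (4) assemble
  rw [QTw_one_apply F h Q hQ0 hQs (fun b : PBond (F.P K) 0 => X (b.translate (-basePt F n K))) c, QTwS_one_apply]
  refine Eq.trans ?_ hsplit
  rw [hG, hT, htgt, hsrc, ← hΨtgt, ← hΨsrc]
  abel

end Main




end Summit.QuantumFields.YangMills.Theorems.Prop7DefectTelescopeMember

end
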